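import Summits.RiemannHypothesis.RiemannHypothesis.Theorems.MotivicDoorFunctionFieldInstances
import Literature.AlgebraicGeometry.Motives.AbelianVarietyHondaTateOrdinary

/-!
# The function-field door (FF-DOOR, statement (ii)) — part 6: caveat (3) ORDINARY as a theorem
(pub-rhdoor, seat ff-2, gen 3; HONEST FRAMING: lottery ticket at the motivic door; RH probability
negligible; consolation prizes are real: a new semi-local Weil-positivity theorem, or a located gap in the
Connes–Consani programme, plus the ff-door theorem.  Nothing in this file is a statement about `ζ`.)

The door theorem `rh_iff_exists_pow_geometric` says: RH(q, h) iff SOME power `h^E` is the characteristic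
polynomial of the Frobenius of an abelian variety over `K = 𝔽_q`; parts 1–4 computed the exact exponent
set from Honda–Tate periods.  Caveat (3) of FF-DOOR §(ii) — "all `e > 1` phenomena are non-ordinary" —
was prose so far.  Howe 1995, Thm. (3.3) (Honda–Tate for ordinary varieties; Literature named fact
`AbelianVariety.hondaTateOrdinary K`, Definition (3.2) `IsOrdinaryWeilPoly p q h` recorded literally)
makes it a typed statement: for an ORDINARY Weil `q`-polynomial (monic, even degree `2g`, all complex
roots of absolute value `√q`, coefficient of `x^g` prime to `p = char K`) the exponent is ONE.

* `geometric_of_ordinary` — an ordinary Weil `q`-polynomial of positive degree IS a `P_A` (the fact, in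
  door language); `forall_pow_geometric_of_ordinary`, `admissibleExponents_of_ordinary` — every power is
  geometric: the admissible exponent set is all of `ℕ_{≥1}` (generator `L = 1`).  [PROVED from hO]
* `period_eq_one_of_ordinary`, `isHTPeriod_one_of_ordinary` — an irreducible ordinary Weil
  `q`-polynomial has Honda–Tate period `1`.  [PROVED from hO (+ hT, hPW for the uniqueness reading;
  + hHT for existence)]
* `ringChar_eq_of_natCard_eq` — `#K = p^n`, `p` prime ⇒ `char K = p`; `norm_eq_sqrt_of_quadratic_root` —
  a complex root of `x² - a x + b` (`a, b ∈ ℤ`, `a² < 4b`) has absolute value `√b`;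
  `isOrdinaryWeilPoly_quadratic` — `x² - a x + q` with `a² < 4q` and `p ∤ a` is an ordinary Weil
  `q`-polynomial.  [PROVED]
* `elliptic_geometric_of_ordinary` — hence, given hO, every such `x² - a x + q` over `#K = q = p^n` is the
  `P_A` of an abelian variety of dimension `1` over `K`; instance `geometric_F2_x2_sub_x_add_2`
  (`q = 2`, `x² - x + 2`).  [PROVED from hO]
* `not_isOrdinaryWeilPoly_traceSq` — the twin family `x² - t x + t²` with `p ∣ t` is NOT ordinary; in
  particular both twins `(4, x² - 2x + 4)` (`p = t = 2`) and `(49, x² - 7x + 49)` (`p = t = 7`) are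
  non-ordinary [PROVED], although the first has period `1` [DATA, isogeny class 1.4.ac]: "ordinary ⇒
  exponent `1`" is an implication, not an equivalence, exactly as caveat (3) says.

Trust base of this file: `hondaTateOrdinary` (Howe Thm. 3.3, new named fact, D-0026 debt +1) for the
`E = 1` statements; `tateSimpleRigidity`, `frobCharpolyProdSimple`, `hondaTateExistence` only where a
period is read.  The door theorem itself is untouched (hW, hHT).
-/

set_option linter.dupNamespace false  -- the mandated namespace repeats `RiemannHypothesis`

open Polynomial

namespace Summit.RiemannHypothesis.RiemannHypothesis.Theorems.MotivicDoor.FunctionField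

open Literature.AlgebraicGeometry.Motives
open Summit.RiemannHypothesis.RiemannHypothesis.Theorems.PfPersistence.FfAngleTwin

universe u

variable {K : Type u} [Field K] [Finite K]

/-! ### Arithmetic preliminaries -/

/-- `#K = p^n` with `p` prime forces `char K = p`. [PROVED] -/
theorem ringChar_eq_of_natCard_eq {p n : ℕ} (hp : p.Prime) (hK : Nat.card K = p ^ n) :
    ringChar K = p := by
  haveI := Fintype.ofFinite K
  haveI : CharP K (ringChar K) := ringChar.charP K
  obtain ⟨m, hr, hcard⟩ := FiniteField.card K (ringChar K)
  rw [Nat.card_eq_fintype_card] at hK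
  have hdvd : ringChar K ∣ p ^ n := by
    rw [← hK, hcard]; exact dvd_pow_self _ m.ne_zero
  rcases (Nat.dvd_prime hp).1 (hr.dvd_of_dvd_pow hdvd) with h1 | h2
  · exact absurd h1 hr.one_lt.ne'
  · exact h2

/-- A complex root `α` of `x² - a x + b` (`a, b ∈ ℤ`, negative discriminant `a² < 4b`) has `|α| = √b`:
writing `α = x + iy`, the imaginary part of the equation gives `y (2x - a) = 0`, `y = 0` is impossible,
so `2x = a` and `x² + y² = b`. [PROVED] -/
theorem norm_eq_sqrt_of_quadratic_root {a b : ℤ} (hdisc : a ^ 2 < 4 * b) {α : ℂ}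
    (hα : α ^ 2 - (a : ℂ) * α + (b : ℂ) = 0) : ‖α‖ = Real.sqrt (b : ℝ) := by
  have hdisc' : ((a : ℝ)) ^ 2 < 4 * (b : ℝ) := by exact_mod_cast hdisc
  have hre := congrArg Complex.re hα
  have him := congrArg Complex.im hα
  simp only [sq, Complex.sub_re, Complex.add_re, Complex.mul_re, Complex.intCast_re,
    Complex.intCast_im, Complex.zero_re, zero_mul, sub_zero, Complex.sub_im, Complex.add_im,
    Complex.mul_im, add_zero, Complex.zero_im] at hre him
  -- hre : x*x - y*y - a*x + b = 0 ;  him : x*y + y*x - a*y = 0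
  have hy : α.im * (2 * α.re - a) = 0 := by linear_combination him
  have hx : 2 * α.re = a := by
    rcases mul_eq_zero.1 hy with hy0 | hx0
    · exfalso
      rw [hy0, mul_zero, sub_zero] at hre
      nlinarith [sq_nonneg (2 * α.re - a)]
    · linarith
  have hsq : α.re * α.re + α.im * α.im = b := by linear_combination (-1 : ℝ) * hre + α.re * hx
  rw [Complex.norm_def, Complex.normSq_apply, hsq]

/-- **Ordinary elliptic Weil polynomials.**  `x² - a x + q` with `a² < 4q` and `p ∤ a` is an ordinary
Weil `q`-polynomial in the sense of Howe, Definition (3.2) (`g = 1`, middle coefficient `-a`). [PROVED] -/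
theorem isOrdinaryWeilPoly_quadratic {p q : ℕ} {a : ℤ} (hdisc : a ^ 2 < 4 * (q : ℤ))
    (hpa : ¬ ((p : ℤ) ∣ a)) : IsOrdinaryWeilPoly p q (X ^ 2 - C a * X + C (q : ℤ)) := by
  have hmon : (X ^ 2 - C a * X + C (q : ℤ) : ℤ[X]).Monic := by monicity!
  have hdeg : (X ^ 2 - C a * X + C (q : ℤ) : ℤ[X]).natDegree = 2 := by compute_degree!
  refine ⟨hmon, ⟨1, by rw [hdeg], ?_⟩, ?_⟩
  · have hc : (X ^ 2 - C a * X + C (q : ℤ) : ℤ[X]).coeff 1 = -a := by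
      rw [coeff_add, coeff_sub, coeff_C_mul, coeff_X_pow, coeff_C, coeff_X_one]; norm_num
    rw [hc, dvd_neg]; exact hpa
  · intro α hα
    have hne : (X ^ 2 - C a * X + C (q : ℤ) : ℤ[X]).map (Int.castRingHom ℂ) ≠ 0 :=
      (hmon.map _).ne_zero
    have hroot := (Polynomial.mem_roots hne).1 hα
    have h2 : α ^ 2 - (a : ℂ) * α + ((q : ℤ) : ℂ) = 0 := by
      simpa [Polynomial.eval_map] using hroot
    have := norm_eq_sqrt_of_quadratic_root hdisc h2
    simpa using this

/-- The twin family `x² - t x + t²` with `p ∣ t` is NOT ordinary (middle coefficient `-t`). In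
particular both twins `(4, x² - 2x + 4)` and `(49, x² - 7x + 49)` (`t = p`) are non-ordinary, although
the first has Honda–Tate period `1` (DATA): "ordinary ⇒ exponent `1`" is not an equivalence. [PROVED] -/
theorem not_isOrdinaryWeilPoly_traceSq {p q t : ℕ} (hpt : p ∣ t) :
    ¬ IsOrdinaryWeilPoly p q (X ^ 2 - C (t : ℤ) * X + C ((t : ℤ) ^ 2)) := by
  apply not_isOrdinaryWeilPoly_of_dvd_coeff_half
  rw [natDegree_traceSq]
  have hc : (X ^ 2 - C (t : ℤ) * X + C ((t : ℤ) ^ 2) : ℤ[X]).coeff 1 = -(t : ℤ) := by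
    rw [coeff_add, coeff_sub, coeff_C_mul, coeff_X_pow, coeff_C, coeff_X_one]; norm_num
  rw [show 2 / 2 = 1 from rfl, hc, dvd_neg]
  exact_mod_cast hpt

/-! ### Exponent one for ordinary Weil polynomials -/

/-- **Caveat (3) as a theorem: an ordinary Weil `q`-polynomial is geometric AT EXPONENT ONE.**
Howe's Thm. (3.3) in door language: every ordinary Weil `q`-polynomial of positive degree (`q = #K`,
`p = char K`) is the characteristic polynomial of the Frobenius of an abelian variety over `K` — no
power needed. [PROVED from hO — it IS the named fact] -/
theorem geometric_of_ordinary (hO : AbelianVariety.hondaTateOrdinary K) {h : ℤ[X]}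
    (hord : IsOrdinaryWeilPoly (ringChar K) (Nat.card K) h) (hdeg : 0 < h.natDegree) :
    ∃ A : AbelianVariety K, A.IsFrobCharpoly h :=
  hO h hord hdeg

/-- … hence EVERY power of an ordinary Weil `q`-polynomial is geometric. [PROVED from hO] -/
theorem forall_pow_geometric_of_ordinary (hO : AbelianVariety.hondaTateOrdinary K) {h : ℤ[X]}
    (hord : IsOrdinaryWeilPoly (ringChar K) (Nat.card K) h) (hdeg : 0 < h.natDegree) {E : ℕ}
    (hE : 0 < E) : ∃ C : AbelianVariety K, C.IsFrobCharpoly (h ^ E) := by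
  obtain ⟨A, hA⟩ := geometric_of_ordinary hO hord hdeg
  exact AbelianVariety.exists_isFrobCharpoly_pow hA hE

/-- The admissible exponent set of an ordinary Weil `q`-polynomial is all of `ℕ_{≥ 1}` (generator
`L = 1` in the exact exponent theorem). [PROVED from hO] -/
theorem admissibleExponents_of_ordinary (hO : AbelianVariety.hondaTateOrdinary K) {h : ℤ[X]}
    (hord : IsOrdinaryWeilPoly (ringChar K) (Nat.card K) h) (hdeg : 0 < h.natDegree) :
    {E : ℕ | 0 < E ∧ ∃ C : AbelianVariety K, C.IsFrobCharpoly (h ^ E)} = {E : ℕ | 0 < E} := by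
  ext E
  simp only [Set.mem_setOf_eq]
  exact ⟨fun hE' => hE'.1, fun hE => ⟨hE, forall_pow_geometric_of_ordinary hO hord hdeg hE⟩⟩

/-- **An irreducible ordinary Weil `q`-polynomial has Honda–Tate period `1`** (reading the period
through `isFrobCharpoly_irreducible_iff_period_eq_one`). [PROVED from hO, hT, hPW] -/
theorem period_eq_one_of_ordinary (hT : AbelianVariety.tateSimpleRigidity K)
    (hPW : AbelianVariety.frobCharpolyProdSimple K) (hO : AbelianVariety.hondaTateOrdinary K)
    {m : ℤ[X]} (hirr : Irreducible m) (hord : IsOrdinaryWeilPoly (ringChar K) (Nat.card K) m)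
    {e : ℕ} (he : IsHTPeriod K m e) : e = 1 :=
  (isFrobCharpoly_irreducible_iff_period_eq_one hT hPW hord.monic hirr he).1
    (geometric_of_ordinary hO hord (hord.monic.natDegree_pos.2 hirr.ne_one))

/-- … so `IsHTPeriod K m 1` holds for every irreducible ordinary Weil `q`-polynomial `m`.
[PROVED from hHT (a period exists), hT, hPW (it is unique), hO (it is `1`)] -/
theorem isHTPeriod_one_of_ordinary (hHT : AbelianVariety.hondaTateExistence K)
    (hT : AbelianVariety.tateSimpleRigidity K) (hPW : AbelianVariety.frobCharpolyProdSimple K)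
    (hO : AbelianVariety.hondaTateOrdinary K) {m : ℤ[X]} (hirr : Irreducible m)
    (hord : IsOrdinaryWeilPoly (ringChar K) (Nat.card K) m) : IsHTPeriod K m 1 := by
  obtain ⟨e, he⟩ := exists_isHTPeriod_of_rh hHT hord.monic hirr hord.rh
  obtain rfl := period_eq_one_of_ordinary hT hPW hO hirr hord he
  exact he

/-! ### Instances: ordinary elliptic Weil polynomials -/

/-- **Every ordinary elliptic Weil `q`-polynomial is a `P_A` of dimension one.**  Over `#K = q = p^n`,
`p` prime: for `a ∈ ℤ` with `a² < 4q` and `p ∤ a`, `x² - a x + q` is the characteristic polynomial of the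
Frobenius of an abelian variety of dimension `1` over `K` (consistent with Waterhouse Thm. 4.1 (1);
here from Howe Thm. 3.3). [PROVED from hO] -/
theorem elliptic_geometric_of_ordinary (hO : AbelianVariety.hondaTateOrdinary K) {p n : ℕ}
    (hp : p.Prime) (hK : Nat.card K = p ^ n) {a : ℤ} (hdisc : a ^ 2 < 4 * ((p ^ n : ℕ) : ℤ))
    (hpa : ¬ ((p : ℤ) ∣ a)) :
    ∃ A : AbelianVariety K, A.dim = 1 ∧ A.IsFrobCharpoly (X ^ 2 - C a * X + C ((p ^ n : ℕ) : ℤ)) := by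
  have hord : IsOrdinaryWeilPoly (ringChar K) (Nat.card K) (X ^ 2 - C a * X + C ((p ^ n : ℕ) : ℤ)) := by
    rw [ringChar_eq_of_natCard_eq hp hK, hK]
    exact isOrdinaryWeilPoly_quadratic hdisc hpa
  have hdeg : (X ^ 2 - C a * X + C ((p ^ n : ℕ) : ℤ) : ℤ[X]).natDegree = 2 := by compute_degree!
  obtain ⟨A, hA⟩ := geometric_of_ordinary hO hord (by rw [hdeg]; norm_num)
  refine ⟨A, ?_, hA⟩
  have h2 := hA.natDegree_eq_two_mul_dim
  rw [hdeg] at h2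
  omega

/-- Instance `q = 2`: `x² - x + 2` (`a = 1`, `a² = 1 < 8`, `2 ∤ 1`) is the `P_A` of an abelian variety of
dimension `1` over any field with two elements. [PROVED from hO] -/
theorem geometric_F2_x2_sub_x_add_2 (hO : AbelianVariety.hondaTateOrdinary K) (hK : Nat.card K = 2) :
    ∃ A : AbelianVariety K, A.dim = 1 ∧ A.IsFrobCharpoly (X ^ 2 - X + 2) := by
  have h := elliptic_geometric_of_ordinary hO (p := 2) (n := 1) Nat.prime_two (by simpa using hK)
    (a := 1) (by norm_num) (by norm_num)
  simpa using h

end Summit.RiemannHypothesis.RiemannHypothesis.Theorems.MotivicDoor.FunctionField
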